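import Summits.QuantumAdvantage.AdviceFreeQNC0.AffBells22WalkHardAllSubcube
import Summits.QuantumAdvantage.AdviceFreeQNC0.WindowLocalHard
import Summits.QuantumAdvantage.AdviceFreeQNC0.WalkTransport
import HarnessLib

/-!
# Cell qa-qnc0 — THE COMB THEOREM for a 3-separated candidate set of polylog size (1/3): fibres

Cell qa-qnc0, crux stmt-QuantumAdvantage-22907 (route DWalkThree).  AUTHORED AND PROVED BY THE PLANNER qa-qnc0-p1 gen 36 (ROUND-35 §4.10 (7)(8′), INBOX 14:05Z/14:12Z, evidence #53 on stmt-22907, file `HOME/qa-qnc0-p1/exp36/CombGateJ37.lean` v3, 840 lines, rc 0 / 0 sorries); landed verbatim by qn-prover-3 g21 as a mechanical three-way split (≤ 400 lines each): `CombGateJ37Fibre` (flips, candidates, Steps 2a–2c) → `CombGateJ37Count` (Steps 1, 3) → `CombGateJ37` (Steps 4–7: `comb_leJ`, `gateSum_flipAt`, `gateGated_leJ`, `exists_isComb_sub`, `denseGate_le`, `three_window`).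

This part: `flipAt`, `IsComb J` (positions `1 ≤ j`, `j+1 < n`, pairwise distance `≥ 3`), `nbEq`, `Good`, `Wset` and their congruence under
agreement off the good candidates; Step 2a `sigma_const` (a selector blind to admissible flips is constant on every fibre); Step 2b
`hasDeg_comp_merge` (degree transfer to the fibre); Step 2c `fibre_le` (the fibre bound via the subcube walk law).
-/

noncomputable section

open Classical

namespace Summit.QuantumAdvantage.AdviceFreeQNC0

open Finset
open Literature.Computability.MetaComplexity Literature.Computability.MetaComplexity.Smolensky
open AffBells22 Subcube

namespace Comb37J

variable {n : ℕ}

/-! ### flips, candidates, good candidates -/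

/-- flip the bit at `j`. -/
def flipAt (u : Fin n → Bool) (j : Fin n) : Fin n → Bool := Function.update u j (!u j)

/-- `flipAt u j` negates coordinate `j`. -/
@[simp] theorem flipAt_self (u : Fin n → Bool) (j : Fin n) : flipAt u j j = !u j := by
  unfold flipAt; rw [Function.update_self]

/-- `flipAt u j` does not change coordinates other than `j`. -/
theorem flipAt_ne (u : Fin n → Bool) {j i : Fin n} (h : i ≠ j) : flipAt u j i = u i := by
  unfold flipAt; rw [Function.update_of_ne h]

/-- `flipAt · j` is an involution. -/
theorem flipAt_flipAt (u : Fin n → Bool) (j : Fin n) : flipAt (flipAt u j) j = u := by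
  funext i
  by_cases h : i = j
  · subst h; rw [flipAt_self, flipAt_self, Bool.not_not]
  · rw [flipAt_ne _ h, flipAt_ne _ h]

/-- admissible candidate sets: positions `1 ≤ j`, `j + 1 < n` (both neighbours exist), pairwise distance `≥ 3`
(neighbour pairs of distinct candidates are disjoint and no candidate is another's second neighbour). -/
structure IsComb (J : Finset (Fin n)) : Prop where
  one_le : ∀ j ∈ J, 1 ≤ j.val
  succ_lt : ∀ j ∈ J, j.val + 1 < n
  sep : ∀ j ∈ J, ∀ j' ∈ J, j.val < j'.val → j.val + 3 ≤ j'.val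

variable {J : Finset (Fin n)}

/-- the neighbour-equality bit `[u_{j−1} = u_{j+1}]`. -/
def nbEq (u : Fin n → Bool) (j : Fin n) : Bool := (uExt u (j.val - 1) == uExt u (j.val + 1))

/-- good candidates of `u` for the relation table `rel`: the flip at `j` is admissible iff `[u_{j−1} = u_{j+1}] = rel j`. -/
def Good (J : Finset (Fin n)) (rel : Fin n → Bool) (u : Fin n → Bool) : Finset (Fin n) := J.filter fun j => nbEq u j = rel j

/-- the fixed set: everything but the good candidates. -/
def Wset (J : Finset (Fin n)) (rel : Fin n → Bool) (u : Fin n → Bool) : Finset (Fin n) := (Good J rel u)ᶜ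

/-- Good candidates are candidates. -/
theorem good_sub (rel : Fin n → Bool) (u : Fin n → Bool) : Good J rel u ⊆ J := filter_subset _ _

/-- Membership in the frozen set `Wset` = not a good candidate. -/
theorem mem_Wset {rel : Fin n → Bool} {u : Fin n → Bool} {i : Fin n} : i ∈ Wset J rel u ↔ i ∉ Good J rel u := by
  unfold Wset; rw [mem_compl]

/-- The complement of `Wset` has the cardinality of the good candidates. -/
theorem card_Wset (rel : Fin n → Bool) (u : Fin n → Bool) : n - (Wset J rel u).card = (Good J rel u).card := by
  unfold Wset
  rw [card_compl, Fintype.card_fin]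
  have : (Good J rel u).card ≤ n := by
    calc (Good J rel u).card ≤ (univ : Finset (Fin n)).card := card_le_univ _
      _ = n := by rw [card_univ, Fintype.card_fin]
  omega

/-- a non-candidate is fixed. -/
theorem mem_Wset_of_not_mem {rel : Fin n → Bool} {u : Fin n → Bool} {i : Fin n} (h : i ∉ J) :
    i ∈ Wset J rel u := by
  rw [mem_Wset]; exact fun hi => h (good_sub rel u hi)

/-- the left neighbour of a candidate is fixed. -/
theorem left_mem_Wset (hJ : IsComb J) {rel : Fin n → Bool} {u : Fin n → Bool} {j : Fin n} (hj : j ∈ J)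
    (h : j.val - 1 < n) : (⟨j.val - 1, h⟩ : Fin n) ∈ Wset J rel u := by
  have h1 := hJ.one_le j hj
  refine mem_Wset_of_not_mem fun hc => ?_
  by_cases hlt : (⟨j.val - 1, h⟩ : Fin n).val < j.val
  · have := hJ.sep _ hc j hj hlt; simp only at this; omega
  · simp only at hlt; omega

/-- the right neighbour of a candidate is fixed. -/
theorem right_mem_Wset (hJ : IsComb J) {rel : Fin n → Bool} {u : Fin n → Bool} {j : Fin n} (hj : j ∈ J)
    (h : j.val + 1 < n) : (⟨j.val + 1, h⟩ : Fin n) ∈ Wset J rel u := by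
  refine mem_Wset_of_not_mem fun hc => ?_
  have := hJ.sep j hj _ hc (by simp only; omega); simp only at this; omega

/-- points agreeing on the fixed set of `a` have the same neighbour bits at every candidate. -/
theorem nbEq_congr (hJ : IsComb J) {rel : Fin n → Bool} {a u : Fin n → Bool} (hu : ∀ i ∈ Wset J rel a, u i = a i)
    {j : Fin n} (hj : j ∈ J) : nbEq u j = nbEq a j := by
  have h2 : j.val + 1 < n := hJ.succ_lt j hj
  have h1 : j.val - 1 < n := by omega
  unfold nbEq uExt
  rw [dif_pos h1, dif_pos h2, dif_pos h1, dif_pos h2, hu _ (left_mem_Wset hJ hj h1), hu _ (right_mem_Wset hJ hj h2)]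

/-- hence the same good set and the same fixed set. -/
theorem good_congr (hJ : IsComb J) {rel : Fin n → Bool} {a u : Fin n → Bool}
    (hu : ∀ i ∈ Wset J rel a, u i = a i) : Good J rel u = Good J rel a := by
  unfold Good
  refine filter_congr fun j hj => ?_
  rw [nbEq_congr hJ hu hj]

/-- `Wset` is unchanged by modifications on the good candidates (comb separation). -/
theorem Wset_congr (hJ : IsComb J) {rel : Fin n → Bool} {a u : Fin n → Bool}
    (hu : ∀ i ∈ Wset J rel a, u i = a i) : Wset J rel u = Wset J rel a := by
  unfold Wset; rw [good_congr hJ hu]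

/-! ### Step 2a: a selector blind to admissible flips is constant on every fibre -/

/-- **Flip connectivity.**  If `σ` is invariant under every admissible flip, then `σ` is constant on the fibre
`{u : u = a on Wset J rel a}`. -/
theorem sigma_const (hJ : IsComb J) {T : Type} (σ : (Fin n → Bool) → T) (rel : Fin n → Bool)
    (hσ : ∀ (u : Fin n → Bool) (j : Fin n), j ∈ J → nbEq u j = rel j → σ (flipAt u j) = σ u)
    (a : Fin n → Bool) :
    ∀ u : Fin n → Bool, (∀ i ∈ Wset J rel a, u i = a i) → σ u = σ a := by
  -- induction on the number of coordinates where `u` and `a` differ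
  suffices h : ∀ d : ℕ, ∀ u : Fin n → Bool, (univ.filter fun i : Fin n => u i ≠ a i).card = d →
      (∀ i ∈ Wset J rel a, u i = a i) → σ u = σ a from
    fun u hu => h _ u rfl hu
  intro d
  induction d with
  | zero =>
    intro u hd _
    have : u = a := by
      funext i
      by_contra hne
      have : i ∈ (univ.filter fun i : Fin n => u i ≠ a i) := mem_filter.2 ⟨mem_univ _, hne⟩
      rw [card_eq_zero] at hd
      rw [hd] at this
      simp at this
    rw [this]
  | succ d ih =>
    intro u hd hu
    -- a differing coordinate
    obtain ⟨i, hi⟩ : (univ.filter fun i : Fin n => u i ≠ a i).Nonempty := by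
      rw [← card_pos, hd]; exact Nat.succ_pos d
    have hia : u i ≠ a i := (mem_filter.1 hi).2
    have hiW : i ∉ Wset J rel a := fun h => hia (hu i h)
    have hiG : i ∈ Good J rel a := by rw [mem_Wset, not_not] at hiW; exact hiW
    have hic : i ∈ J := good_sub rel a hiG
    have hrel : nbEq a i = rel i := (mem_filter.1 hiG).2
    -- flip it back
    set u' := flipAt u i with hu'
    have hu'W : ∀ k ∈ Wset J rel a, u' k = a k := by
      intro k hk
      have hki : k ≠ i := fun h => hiW (h ▸ hk)
      rw [hu', flipAt_ne _ hki]; exact hu k hk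
    have hcard : (univ.filter fun k : Fin n => u' k ≠ a k).card = d := by
      have he : (univ.filter fun k : Fin n => u' k ≠ a k) = (univ.filter fun k : Fin n => u k ≠ a k).erase i := by
        ext k
        rw [mem_erase, mem_filter, mem_filter]
        by_cases hki : k = i
        · subst hki
          simp only [mem_univ, true_and, ne_eq, not_true_eq_false, false_and, iff_false, not_not]
          rw [hu', flipAt_self]
          revert hia; cases u k <;> cases a k <;> simp
        · rw [hu', flipAt_ne _ hki]
          simp [hki]
      rw [he, card_erase_of_mem hi, hd]; rfl
    have h1 : σ u' = σ a := ih u' hcard hu'W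
    have h2 : σ u = σ u' := by
      have : u = flipAt u' i := by rw [hu', flipAt_flipAt]
      rw [this]
      exact hσ u' i hic (by rw [nbEq_congr hJ hu'W hic, hrel])
    rw [h2, h1]

/-! ### Step 2b: degree transfer to the fibre -/

/-- Degree does not grow under a subcube merge (every coordinate is a constant or a variable). -/
theorem hasDeg_comp_merge {D : ℕ} {h : (Fin n → Bool) → Bool} (hh : HasDeg h D) (W : Finset (Fin n))
    (a : Fin n → Bool) : HasDeg (fun u => h (subcubeMerge W a u)) D := by
  unfold HasDeg at hh ⊢
  refine comp_mem_lowDeg_of_coord (F := ZMod 2) (subcubeMerge W a) (fun i => ?_) hh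
  by_cases hi : i ∈ W
  · by_cases ha : a i = true
    · have e : (fun u : Fin n → Bool => if subcubeMerge W a u i = true then (1 : ZMod 2) else 0)
          = mono (ZMod 2) (∅ : Finset (Fin n)) := by
        funext u; unfold subcubeMerge; rw [if_pos hi, if_pos ha, mono_empty]; rfl
      rw [e]; exact mono_mem_lowDeg (by simp)
    · have e : (fun u : Fin n → Bool => if subcubeMerge W a u i = true then (1 : ZMod 2) else 0) = 0 := by
        funext u; unfold subcubeMerge; rw [if_pos hi, if_neg ha]; rfl
      rw [e]; exact Submodule.zero_mem _
  · have e : (fun u : Fin n → Bool => if subcubeMerge W a u i = true then (1 : ZMod 2) else 0)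
        = mono (ZMod 2) ({i} : Finset (Fin n)) := by
      funext u
      rw [mono_apply]
      simp only [Finset.mem_singleton, forall_eq]
      unfold subcubeMerge
      rw [if_neg hi]
    rw [e]; exact mono_mem_lowDeg (by simp)

/-! ### Step 2c: the fibre bound -/

/-- points of the fibre `{u = a on W}` are exactly the extensions `ext W a v`. -/
theorem filter_agree_eq_image (W : Finset (Fin n)) (a : Fin n → Bool) (Q : (Fin n → Bool) → Prop)
    [DecidablePred Q] :
    (univ.filter fun u : Fin n → Bool => (∀ i ∈ W, u i = a i) ∧ Q u) =
      (univ.filter fun v : Fin (n - W.card) → Bool => Q (ext W a v)).image (ext W a) := by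
  ext u
  rw [mem_filter, mem_image]
  constructor
  · rintro ⟨-, hW, hQ⟩
    have hu : ext W a (res W u) = u := by
      rw [← merge_eq_ext_res]
      funext i
      unfold subcubeMerge
      by_cases hi : i ∈ W
      · rw [if_pos hi, hW i hi]
      · rw [if_neg hi]
    refine ⟨res W u, mem_filter.2 ⟨mem_univ _, by rw [hu]; exact hQ⟩, hu⟩
  · rintro ⟨v, hv, rfl⟩
    exact ⟨mem_univ _, fun i hi => ext_of_mem W a v hi, (mem_filter.1 hv).2⟩

/-- Counting the points of a fibre (agreement with `a` on `W`) satisfying `Q` via the subcube merge. -/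
theorem card_filter_agree (W : Finset (Fin n)) (a : Fin n → Bool) (Q : (Fin n → Bool) → Prop)
    [DecidablePred Q] :
    (univ.filter fun u : Fin n → Bool => (∀ i ∈ W, u i = a i) ∧ Q u).card =
      (univ.filter fun v : Fin (n - W.card) → Bool => Q (ext W a v)).card := by
  rw [filter_agree_eq_image, card_image_of_injective]
  intro v v' h
  have := congrArg (res W) h
  rwa [res_ext, res_ext] at this

/-- the whole fibre has `2^{n − |W|}` points. -/
theorem card_agree (W : Finset (Fin n)) (a : Fin n → Bool) :
    (univ.filter fun u : Fin n → Bool => ∀ i ∈ W, u i = a i).card = 2 ^ (n - W.card) := by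
  have h := card_filter_agree W a (fun _ => True)
  have e1 : (univ.filter fun u : Fin n → Bool => (∀ i ∈ W, u i = a i) ∧ True) =
      univ.filter fun u : Fin n → Bool => ∀ i ∈ W, u i = a i := filter_congr fun u _ => by simp
  have e2 : (univ.filter fun _v : Fin (n - W.card) → Bool => True) = univ := filter_true_of_mem fun _ _ => trivial
  rw [e1, e2, card_univ, Fintype.card_fun, Fintype.card_bool, Fintype.card_fin] at h
  exact h

/-- **THE FIBRE BOUND.**  On the fibre of `a` (free set `Good J rel a`), a gated strategy with an admissible-flip-blind
selector and window-local branches wins on at most `(1 − c₀)·2^{|Good J rel a|}` points, as soon as the free set is large: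
`|Good J rel a| ≥ m₀` and `16 r² ≤ |Good J rel a|` (`r` the window). -/
theorem fibre_le {c₀ : ℝ} {m₀ : ℕ}
    (hcore : ∀ m ≥ m₀, ∀ D : ℕ, D ≤ Nat.sqrt m →
      ∀ f : (Fin m → Bool) → F4, f ∈ fullSpan m D → c₀ * (2 : ℝ) ^ m ≤ ((failSetOf f).card : ℝ))
    (hJ : IsComb J) {T : Type} (σ : (Fin n → Bool) → T) (rel : Fin n → Bool) (r : ℕ)
    (G : T → Fin (n + 1) → (Fin n → Bool) → Bool)
    (hσ : ∀ (u : Fin n → Bool) (j : Fin n), j ∈ J → nbEq u j = rel j → σ (flipAt u j) = σ u)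
    (hloc : ∀ t, WindowLocal r (G t)) (c : ℕ) (a : Fin n → Bool)
    (hm : m₀ ≤ (Good J rel a).card) (hr : 16 * r ^ 2 ≤ (Good J rel a).card) :
    ((univ.filter fun u : Fin n → Bool => (∀ i ∈ Wset J rel a, u i = a i) ∧
        ringWinU c (fun g u => G (σ u) g u) u = true).card : ℝ) ≤ (1 - c₀) * (2 : ℝ) ^ (Good J rel a).card := by
  set W := Wset J rel a with hW
  have hfree : n - W.card = (Good J rel a).card := card_Wset rel a
  -- on the fibre the gated strategy is the branch `G (σ a)`
  have heq : (univ.filter fun u : Fin n → Bool => (∀ i ∈ W, u i = a i) ∧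
        ringWinU c (fun g u => G (σ u) g u) u = true) =
      univ.filter fun u : Fin n → Bool => (∀ i ∈ W, u i = a i) ∧ ringWinU c (G (σ a)) u = true := by
    refine filter_congr fun u _ => ?_
    constructor
    · rintro ⟨hWu, hwin⟩
      refine ⟨hWu, ?_⟩
      have hs : σ u = σ a := sigma_const hJ σ rel hσ a u hWu
      have : ringWinU c (fun g u => G (σ u) g u) u = ringWinU c (G (σ a)) u := by
        simp only [ringWinU, hs]
      rw [← this]; exact hwin
    · rintro ⟨hWu, hwin⟩
      refine ⟨hWu, ?_⟩
      have hs : σ u = σ a := sigma_const hJ σ rel hσ a u hWu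
      have : ringWinU c (fun g u => G (σ u) g u) u = ringWinU c (G (σ a)) u := by
        simp only [ringWinU, hs]
      rw [this]; exact hwin
  rw [heq, card_filter_agree W a (fun u => ringWinU c (G (σ a)) u = true)]
  -- the tree's subcube bound
  have hm' : m₀ ≤ n - W.card := by rw [hfree]; exact hm
  have hD : 2 * r ≤ Nat.sqrt (n - W.card) := by
    rw [hfree, Nat.le_sqrt]
    nlinarith
  have hy : ∀ g, HasDeg (fun u => G (σ a) g (subcubeMerge W a u)) (2 * r) :=
    fun g => hasDeg_comp_merge (hasDeg_of_windowLocal (hloc (σ a)) g) W a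
  have h := card_win_ext_le W a hcore hm' hD c (G (σ a)) hy
  calc _ ≤ (1 - c₀) * (2 : ℝ) ^ (n - W.card) := h
    _ = (1 - c₀) * (2 : ℝ) ^ (Good J rel a).card := by rw [hfree]

end Comb37J

end Summit.QuantumAdvantage.AdviceFreeQNC0
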